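import Summits.ValiantsHypothesis.ValiantsHypothesis.Theses.Depth4
import Literature.Computability.AlgebraicComplexity.HomDepthFourUpperBound

/-!
# Birth skeleton for crux `Depth4HomFour` (item stmt-ValiantsHypothesis-11333)

Route `route-ValiantsHypothesis-Depth4` (re-audit bin HONEST-BET-1LEAF). Crux (route decl
`Summit.ValiantsHypothesis.ValiantsHypothesis.Theses.Depth4.Depth4HomFour`):
`∀ c, ∃ n, (n+2)^(c⌊√n⌋+c) < homDepthFourCircuitSize (per_n)` — the permanent needs homogeneous
`ΣΠΣΠ` circuits (Kumar–Saraf discipline `ArithCircuit.IsDepthFour`, every gate homogeneous) of size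
`n^{ω(√n)}`: the chasm crossing (KumarSaraf2017 §10, open), deciding `ValiantsHypothesis` via the
tree's proved depth-4 Tavenas theorem (`closes`).

LINE (`birth`): SPLIT ALONG BOTTOM SUPPORT at the threshold `s(n) = ⌊√n⌋/(log₂ n + 1) + 1 = o(√n)`.
Every unbounded-fan-in depth-4 lower bound in print (KLSS 2017, KumarSaraf2017 Thm. 8.10) is
"circuit side" + "polynomial side": a homogeneous `ΣΠΣΠ^{{s}}` circuit (bottom monomials of support
`≤ s`) of size `S` has projected-shifted-partials measure `Φ ≤ S · #{A ⊆ [2n/s+1] : |A| ≤ r} ·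
∑_{i ≤ rs} C(N, m+i)` — PROVED in the tree for the measure `KumarSaraf.pspDim`
(`KumarSaraf.pspDim_restrict_le`, eq. (4.1)/Lemma 4.1, HomDepthFourUpperBound.lean) — while the hard
polynomial has large `Φ`. The two genuine further steps for the permanent BEYOND the chasm:

* `stub_pspLowSupport` (polynomial side, no circuits): for every `c`, for all large `n`, some
  order-`r` derivative family `L` and shift `m` give
  `Φ_{L,m}(per_n) > (n+2)^(c⌊√n⌋+c) · #{A ⊆ [2n/s+1] : |A| ≤ r} · ∑_{i ≤ rs} C(n², m+i)` at
  `s = s(n)`. With the proved circuit side this is EXACTLY an `n^{ω(√n)}` lower bound for `per_n`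
  against homogeneous `ΣΠΣΠ^{{s(n)}}` circuits — a model strictly between homogeneous `ΣΠΣ`
  (`s = 1`: `2^{Ω(n)}` known, Nisan–Wigderson 1997) and `ΣΠΣΠ^{[√n]}` (`2^{Ω(√n)}` known,
  GuptaKamathKayalSaptharishi2014 Thm. 2). NOT summit-strength: Tavenas for a degree-`n` `VP` family at
  bottom fan-in `√n/log n` only gives size `n^{O(√n·log n)}`, far above every `(n+2)^(c√n+c)`, so the
  stub is consistent with `per` behaving like `det`. Idealised potential of the measure at support
  `s`: ratio `≈ n^{n/(2(s+1))} / 2^{2n/s} = n^{(√n·log n)/2·(1-o(1))} ≫ n^{c√n}` (balance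
  `|L|·C(N,m)` against `C(N, m+n-r)` at `m = N/(1+n^{2r/n})`, `r = n/(2(s+1))`); a GKKS-quality
  (`2^{Ω(n/s)}`) count only reaches `n^{O(√n)}`, so the stub needs the sharp leading-monomial count
  for the permanent (GKKS2014 §8, Conj. 24-type; the `T₁,T₂,T₃ ⟹ Φ` skeleton
  `KumarSaraf.pspDim_mul_ge_of_T123` is proved in the tree). Size XL, technique class known.
* `stub_supportReduction` (circuit side, the BET): at the super-chasm scale, bounded bottom support
  `≤ s(n)` costs the permanent at most a change of the constant: `∀ c ∃ c' n₀ ∀ n ≥ n₀`, a homogeneous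
  depth-4 circuit of size `≤ (n+2)^(c⌊√n⌋+c)` for `per_n` yields one of size `≤ (n+2)^(c'⌊√n⌋+c')`
  all of whose bottom monomials (`ArithCircuit.monoExps`) have support `≤ s(n)`. WHY IT IS THE BET
  (barrier `Literature.Barriers.ValiantsHypothesis.DepthReductionChasmDepthFour` read as an
  invariant): random zero/one-restrictions (KumarSaraf2017 Lemma 8.2) kill `S = n^{c√n}` bad monomials
  of support `> s` only at survival probability `p < S^{-1/s}`, while `per_n|_V ≢ 0` needs `p ≥ n^{-1+o(1)}`,
  forcing `s ≥ c√n`; at `s ≥ c√n` the measure's potential `n^{n/(2s)} ≤ n^{√n/(2c)}` is below `S` for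
  `c ≥ 1` — the product "kill capacity × potential" is pinned at the chasm. Generic re-reduction
  (circuit of size `S` ⇒ `ΣΠ^{[O(n/t)]}ΣΠ^{[t]}` of size `S^{O(t+n/t)}`) squares the exponent. So
  this stub needs a permanent-specific mechanism (Laplace/self-reduction re-balancing of bottom
  factors, multilinearity of `per`: under the multilinear projection inside `pspDim` support = degree)
  — or the line dies here, which is informative: it localises the chasm barrier in ONE typed
  statement about circuits for `per_n`, with the polynomial side a separate, classical target.

`Depth4HomFour_of` assembles them (real proof, no sorry): given `c`, take `c', n₀` from the
reduction and `n₁` from the low-support bound at `c'`; at `n = max (max n₀ n₁) 2`, if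
`homDepthFourCircuitSize per_n ≤ (n+2)^(c√n+c)` then the reduced circuit `P` and
`KumarSaraf.pspDim_restrict_le` at `V = univ` (`restrictVars univ f = f`, proved below) bound
`Φ_{L,m}(per_n) ≤ size(P)·(…) ≤ (n+2)^(c'√n+c')·(…)`, contradicting the stub-1 inequality.

## Shape (skeleton audit by-name rule, as in `Cruxes/Depth3Chasm/Lines/birth.lean`)
* `Stmt.stub_…` — the two stub statements as precise `Prop`s, named like the stubs;
* `stub_…` — the same statements as sorried theorems (the REGISTERED stubs; `sorry` nowhere else);
* `Depth4HomFour_of : Stmt.stub_pspLowSupport → Stmt.stub_supportReduction → Depth4HomFour` — the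
  composition, real proof; `Depth4HomFour_proof : Depth4HomFour := Depth4HomFour_of stub_… stub_…`
  ties the two copies (the compiler checks that the `Stmt` copies and the stub statements agree).
Both stubs are DEF-FREE beyond Mathlib + `Literature.Computability.AlgebraicComplexity`
(`perPoly`, `KumarSaraf.pspDim`, `GKKS.numSubsetsLE`, `ArithCircuit.{Computes, IsDepthFour,
IsHomogeneousCircuit, size, monoExps}`, `homDepthFourCircuitSize`), so each can land as
`Theorems/Depth4Depth4HomFour<Stub>.lean` with `--supports stmt-ValiantsHypothesis-11333`.
Disproof used: none — no `Disproof.lean` / Negative lemma exists for this crux (`ledger crux ls`: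
no workfiles at registration); negatives index (4 entries) unrelated.
-/

namespace Summit.ValiantsHypothesis.ValiantsHypothesis.Cruxes.Depth4HomFour.Birth

open Literature.Computability.AlgebraicComplexity
open MvPolynomial

/-- Statement of STUB 1 (polynomial side; projected shifted partials of the permanent beyond the
chasm at bottom support `s(n) = ⌊√n⌋/(log₂ n + 1) + 1`). For every `c`, for all large `n`, there
are an order `r`, a shift degree `m` and a finite family `L` of order-`r` derivative operators
(lists of `r` variables of `per_n`) with
`(n+2)^(c⌊√n⌋+c) · #{A ⊆ [2n/s+1] : |A| ≤ r} · ∑_{i ≤ rs} C(n², m+i) < Φ_{L,m}(per_n)`,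
`Φ = KumarSaraf.pspDim` (Kumar–Saraf 2017, Def. 3.1). Why plausibly true: the idealised potential
of the measure at support `s = o(√n)` is `n^{n/(2(s+1))}/2^{2n/s} = n^{ω(√n)}` (module docstring);
for `IMM`/`NW` the matching sharp counts are theorems (KumarSaraf2017 Lemma 8.9, KLSS2017), for
`per_n` the sharp leading-monomial count is GKKS2014 §8 (Conj. 24-type) — open combinatorics, known
technique (`KumarSaraf.pspDim_mul_ge_of_T123` is the proved deterministic skeleton). Why it might
fail: the permanent's shifted partials may have determinantal-type dependencies losing an `e^{Θ(n)}`
factor (GKKS's analysis gives only `2^{Ω(n/s)} = n^{O(√n)}` here). Not summit-strength: with the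
proved circuit side it is a lower bound against `ΣΠΣΠ^{{o(√n)}}` only, where Tavenas gives `VP`
families merely `n^{O(√n log n)}`. Size: XL. -/
def Stmt.stub_pspLowSupport : Prop :=
  ∀ c : ℕ, ∃ n₀ : ℕ, ∀ n : ℕ, n₀ ≤ n →
    ∃ (r m : ℕ) (L : Finset (List (Fin n × Fin n))), (∀ l ∈ L, l.length = r) ∧
      (n + 2) ^ (c * Nat.sqrt n + c) *
          (Literature.Computability.AlgebraicComplexity.GKKS.numSubsetsLE
              (2 * n / (Nat.sqrt n / (Nat.log 2 n + 1) + 1) + 1) r *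
            ∑ i ∈ Finset.range (r * (Nat.sqrt n / (Nat.log 2 n + 1) + 1) + 1),
              (Fintype.card (Fin n × Fin n)).choose (m + i)) <
        Literature.Computability.AlgebraicComplexity.KumarSaraf.pspDim
          (fun l : L => (l : List (Fin n × Fin n))) m
          (Literature.Computability.AlgebraicComplexity.perPoly (Fin n) ℂ)

/-- Statement of STUB 2 (circuit side; support reduction for the permanent at the super-chasm
scale — THE BET of the line). For every `c` there are `c', n₀` such that for `n ≥ n₀`: if `per_n`
has a homogeneous depth-4 circuit with at most `(n+2)^(c⌊√n⌋+c)` gates, then it has one with at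
most `(n+2)^(c'⌊√n⌋+c')` gates all of whose bottom monomials (`ArithCircuit.monoExps`) have
support `≤ ⌊√n⌋/(log₂ n + 1) + 1`. Why plausibly true: it is implied by the eventual form of the
crux (antecedent false), and at support `1` (homogeneous `ΣΠΣ`) versus unbounded support nothing
separates the permanent's depth-4 complexities at this scale in print; a permanent-specific
re-balancing (Laplace expansion along `o(√n)` rows, multilinearity) is the intended mechanism.
Why it might fail: every GENERIC mechanism is dead at this scale — random restrictions need
survival probability `< n^{-c√n/s} = n^{-ω(1)}` (then `per|_V ≡ 0`), generic re-reduction costs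
`S^{O(t+n/t)}` (module docstring) — so a proof needs a new, permanent-specific idea; a refutation
would exhibit `n^{O(√n)}` homogeneous depth-4 circuits for `per_n` with high-support bottom
monomials essential, i.e. (nearly) refute the crux itself. Size: XL / open. -/
def Stmt.stub_supportReduction : Prop :=
  ∀ c : ℕ, ∃ c' n₀ : ℕ, ∀ n : ℕ, n₀ ≤ n →
    Literature.Computability.AlgebraicComplexity.homDepthFourCircuitSize
        (Literature.Computability.AlgebraicComplexity.perPoly (Fin n) ℂ) ≤
      ((n + 2 : ℕ∞) ^ (c * Nat.sqrt n + c)) →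
    ∃ P : Literature.Computability.AlgebraicComplexity.ArithCircuit ℂ (Fin n × Fin n),
      P.Computes (Literature.Computability.AlgebraicComplexity.perPoly (Fin n) ℂ) ∧
      P.IsDepthFour ∧ P.IsHomogeneousCircuit ∧
      P.size ≤ (n + 2) ^ (c' * Nat.sqrt n + c') ∧
      ∀ e ∈ P.monoExps, e.support.card ≤ Nat.sqrt n / (Nat.log 2 n + 1) + 1

/-- Registered STUB 1 = `Stmt.stub_pspLowSupport` (projected shifted partials of `per_n` beyond the
chasm at bottom support `o(√n)`). [cite: KumarSaraf2017, Def. 3.1 and Lemma 8.9]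
[cite: GuptaKamathKayalSaptharishi2014, §8] -/
theorem stub_pspLowSupport :
    ∀ c : ℕ, ∃ n₀ : ℕ, ∀ n : ℕ, n₀ ≤ n →
      ∃ (r m : ℕ) (L : Finset (List (Fin n × Fin n))), (∀ l ∈ L, l.length = r) ∧
        (n + 2) ^ (c * Nat.sqrt n + c) *
            (Literature.Computability.AlgebraicComplexity.GKKS.numSubsetsLE
                (2 * n / (Nat.sqrt n / (Nat.log 2 n + 1) + 1) + 1) r *
              ∑ i ∈ Finset.range (r * (Nat.sqrt n / (Nat.log 2 n + 1) + 1) + 1),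
                (Fintype.card (Fin n × Fin n)).choose (m + i)) <
          Literature.Computability.AlgebraicComplexity.KumarSaraf.pspDim
            (fun l : L => (l : List (Fin n × Fin n))) m
            (Literature.Computability.AlgebraicComplexity.perPoly (Fin n) ℂ) := by
  sorry

/-- Registered STUB 2 = `Stmt.stub_supportReduction` (support reduction for the permanent at the
super-chasm scale; the bet). [cite: KumarSaraf2017, Lemma 8.2 and §10] -/
theorem stub_supportReduction :
    ∀ c : ℕ, ∃ c' n₀ : ℕ, ∀ n : ℕ, n₀ ≤ n →
      Literature.Computability.AlgebraicComplexity.homDepthFourCircuitSize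
          (Literature.Computability.AlgebraicComplexity.perPoly (Fin n) ℂ) ≤
        ((n + 2 : ℕ∞) ^ (c * Nat.sqrt n + c)) →
      ∃ P : Literature.Computability.AlgebraicComplexity.ArithCircuit ℂ (Fin n × Fin n),
        P.Computes (Literature.Computability.AlgebraicComplexity.perPoly (Fin n) ℂ) ∧
        P.IsDepthFour ∧ P.IsHomogeneousCircuit ∧
        P.size ≤ (n + 2) ^ (c' * Nat.sqrt n + c') ∧
        ∀ e ∈ P.monoExps, e.support.card ≤ Nat.sqrt n / (Nat.log 2 n + 1) + 1 := by
  sorry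

/-- Helper (glue, proved): restricting to ALL variables is the identity, so the tree's restricted
upper bound `KumarSaraf.pspDim_restrict_le` applies to an unrestricted bounded-support circuit.
[folklore] -/
theorem restrictVars_univ {σ : Type*} [Fintype σ] [DecidableEq σ] {k : Type*} [CommSemiring k]
    (f : MvPolynomial σ k) : restrictVars (Finset.univ : Finset σ) f = f := by
  have h : (fun v : σ => if v ∈ (Finset.univ : Finset σ) then (X v : MvPolynomial σ k) else 0) =
      X := by
    funext v
    simp
  unfold restrictVars
  rw [h, MvPolynomial.aeval_X_left]
  rfl

/-- The EVENTUAL (almost-everywhere) form of the crux: for every `c`, for ALL large `n`,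
`(n+2)^(c⌊√n⌋+c) < homDepthFourCircuitSize (per_n)`. The crux `Depth4HomFour` is its
infinitely-often weakening (`eventually_imp_depth4HomFour`). Used below to pin down the exact
logical strength of STUB 2 (the sandwich `stub_supportReduction_iff_eventually`). -/
def Stmt.eventually : Prop :=
  ∀ c : ℕ, ∃ n₀ : ℕ, ∀ n : ℕ, n₀ ≤ n →
    ((n + 2 : ℕ∞) ^ (c * Nat.sqrt n + c)) <
      Literature.Computability.AlgebraicComplexity.homDepthFourCircuitSize
        (Literature.Computability.AlgebraicComplexity.perPoly (Fin n) ℂ)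

/-- The eventual form implies the crux (take `n = n₀`). [folklore] -/
theorem eventually_imp_depth4HomFour :
    Stmt.eventually → Summit.ValiantsHypothesis.ValiantsHypothesis.Theses.Depth4.Depth4HomFour := by
  intro h c
  obtain ⟨n₀, h'⟩ := h c
  exact ⟨n₀, h' n₀ le_rfl⟩

/-- SANDWICH, upper slice (kernel-checked): the eventual crux implies STUB 2 outright, with
`c' = 0` — its antecedent `homDepthFourCircuitSize per_n ≤ (n+2)^(c⌊√n⌋+c)` is then false for
`n ≥ n₀(c)`. So STUB 2 is AT MOST as strong as the eventual crux. [folklore] -/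
theorem stub_supportReduction_of_eventually : Stmt.eventually → Stmt.stub_supportReduction := by
  intro h c
  obtain ⟨n₀, h'⟩ := h c
  refine ⟨0, n₀, fun n hn hle => ?_⟩
  exact absurd (h' n hn) (not_lt.2 hle)

/-- COMPOSITION in eventual form (kernel-checked, no sorry): the two stub statements imply the
EVENTUAL crux. Given `c`, take `c', n₀` from STUB 2 and `n₁` from STUB 1 at `c'`; for every
`n ≥ max (max n₀ n₁) 2` a homogeneous depth-4 circuit of size `≤ (n+2)^(c⌊√n⌋+c)` would give a
bounded-support one of size `≤ (n+2)^(c'⌊√n⌋+c')`, whose measure bound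
(`KumarSaraf.pspDim_restrict_le` at `V = univ`, eq. (4.1)) contradicts STUB 1. -/
theorem eventually_of_stubs :
    Stmt.stub_pspLowSupport → Stmt.stub_supportReduction → Stmt.eventually := by
  intro hLow hRed
  unfold Stmt.stub_pspLowSupport at hLow
  unfold Stmt.stub_supportReduction at hRed
  intro c
  obtain ⟨c', n₀, hRed'⟩ := hRed c
  obtain ⟨n₁, hLow'⟩ := hLow c'
  refine ⟨max (max n₀ n₁) 2, fun n hn => ?_⟩
  have hn₀ : n₀ ≤ n := (le_max_of_le_left (le_max_left _ _)).trans hn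
  have hn₁ : n₁ ≤ n := (le_max_of_le_left (le_max_right _ _)).trans hn
  have h2 : 2 ≤ n := (le_max_right _ _).trans hn
  by_contra hlt
  rw [not_lt] at hlt
  obtain ⟨P, hc, h4, hh, hsize, hsupp⟩ := hRed' n hn₀ hlt
  obtain ⟨r, m, L, hL, hbig⟩ := hLow' n hn₁
  set s : ℕ := Nat.sqrt n / (Nat.log 2 n + 1) + 1 with hs
  have hs1 : 1 ≤ s := by rw [hs]; exact Nat.le_add_left 1 _
  have hhom : (perPoly (Fin n) ℂ).IsHomogeneous n := by
    simpa only [Fintype.card_fin] using (perPoly_isHomogeneous (n := Fin n) (k := ℂ))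
  have hV : ∀ e ∈ P.monoExps, e.support ⊆ (Finset.univ : Finset (Fin n × Fin n)) →
      e.support.card ≤ s :=
    fun e he _ => hsupp e he
  have hup := KumarSaraf.pspDim_restrict_le hc h4 hh hhom h2 Finset.univ hs1 hV
    (fun l : L => (l : List (Fin n × Fin n))) r (fun l => hL l l.2) m
  rw [restrictVars_univ] at hup
  have hle : KumarSaraf.pspDim (fun l : L => (l : List (Fin n × Fin n))) m (perPoly (Fin n) ℂ) ≤
      (n + 2) ^ (c' * Nat.sqrt n + c') * (GKKS.numSubsetsLE (2 * n / s + 1) r *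
        ∑ i ∈ Finset.range (r * s + 1), (Fintype.card (Fin n × Fin n)).choose (m + i)) :=
    hup.trans (Nat.mul_le_mul_right _ hsize)
  exact absurd hbig (not_lt.2 hle)

/-- SANDWICH (kernel-checked): MODULO STUB 1, STUB 2 IS EXACTLY THE EVENTUAL FORM OF THE CRUX.
This is the precise sense in which `stub_supportReduction` is crux-sized: any proof of it is,
given the polynomial side, a proof of `∀ c ∀^∞ n, (n+2)^(c⌊√n⌋+c) < homDepthFourCircuitSize per_n`,
and conversely. [folklore] -/
theorem stub_supportReduction_iff_eventually (hLow : Stmt.stub_pspLowSupport) :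
    Stmt.stub_supportReduction ↔ Stmt.eventually :=
  ⟨eventually_of_stubs hLow, stub_supportReduction_of_eventually⟩

/-- COMPOSITION (kernel-checked, no sorry): the two stub statements imply the crux `Depth4HomFour`
BY NAME (through the eventual form). -/
theorem Depth4HomFour_of :
    Stmt.stub_pspLowSupport → Stmt.stub_supportReduction →
      Summit.ValiantsHypothesis.ValiantsHypothesis.Theses.Depth4.Depth4HomFour :=
  fun hLow hRed => eventually_imp_depth4HomFour (eventually_of_stubs hLow hRed)

/-- THE SKELETON: the crux, modulo exactly the two registered stubs (the compiler checks that the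
`Stmt` copies and the stub statements agree). -/
theorem Depth4HomFour_proof :
    Summit.ValiantsHypothesis.ValiantsHypothesis.Theses.Depth4.Depth4HomFour :=
  Depth4HomFour_of stub_pspLowSupport stub_supportReduction

end Summit.ValiantsHypothesis.ValiantsHypothesis.Cruxes.Depth4HomFour.Birth
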